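import Summits.AtomisticToContinuum.BoseEinsteinCondensation.Theorems.BoxHorizonTransferFar
import HarnessLib

/-!
# WIT first stub, TYPED (lens-6 g32 addendum to g31 «HorizonTransfer», critic row 441 order (b))

`SubHorizonWitness` (WIT, `Theorems/BoxHorizonTransferFar.lean`) asks, for EVERY `δ > 0`, for SOME
Dirichlet `δ`-near-minimiser with sub-horizon DCT band occupation `≤ N/64`.  The only regime in which a
witness is constructible from print is `δ ≥ δ⋆(N) := C_w · N · ρa · (ρa³)^{1/2+η_w}` — the precision gap
between the LHY-order UPPER bound trial states [Yau–Yin 2009; Basti–Cenatiempo–Schlein 2021, Thm. 1.1;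
hard core: Basti–Cenatiempo–Giuliani–Olgiati–Pasqualetti–Schlein 2023] and the LHY-order LOWER bound
[Fournais–Solovej 2020 Thm. 1.1 / 2023 (hard core)]: such a trial state has total depletion
`N − n₀ ≤ C N √(ρa³) ≤ N/64` below a density cap, hence (Parseval over the block waves, the flat wave's
occupation `≥ n₀ −` coarse-graining loss) sub-horizon band `≤ N/64`, and energy `≤ E₀ + δ⋆`.
`SubHorizonWitnessCoarse` := WIT restricted to `δ ≥ δ⋆(N)` — the RUNG (BC5-type witness of weakness /
first provable stub), strictly WEAKER than WIT, TRUE-type, ATTACKABLE·L (vendoring: the BCS 2021 /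
BCGOPS 2023 trial state's condensate depletion `N − ⟨n₀⟩ ≤ C N √(ρa³)` and the FS 2020/2023 lower bound
as named facts).  HONESTY NOTE (lens-6 g30 dead end «δ-regime split = COSTUME», confirmed here in the
kernel): WIT is `δ`-MONOTONE, so the complementary piece `SubHorizonWitnessFine` (`δ < δ⋆` only) already
implies WIT on its own (`subHorizonWitness_of_fine` below) — the coarse/fine split does NOT reduce WIT;
its value is ONLY the typed provable rung `SubHorizonWitnessCoarse(AllA)`, which is what critic row 441
(b) asked for.  [folklore]
-/

noncomputable section

open MeasureTheory Filter Set
open scoped ENNReal NNReal BigOperators Topology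

namespace Summit.AtomisticToContinuum.BoseEinsteinCondensation.Theorems.BoxHorizonTransfer

open Literature.MathematicalPhysics.QuantumManyBody.BoseGas
open Summit.AtomisticToContinuum.BoseEinsteinCondensation.Theorems.BoxLatticeFSum
open Summit.AtomisticToContinuum.BoseEinsteinCondensation.Theorems.BoxEnergyHorizon

/-- **WIT-coarse** (first stub of WIT · TRUE-type · ATTACKABLE·L · strictly WEAKER than WIT):
`SubHorizonWitness` for excess energies `δ ≥ δ⋆(N) = C_w N ρa (ρa³)^{1/2+η_w}` only — the LHY-precision
trial states are the witnesses. [cite: BastiCenatiempoSchlein2021, Thm. 1.1; FournaisSolovej2020, Thm. 1.1] -/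
@[conjecture] def SubHorizonWitnessCoarse : Prop :=
  ∀ v : ℝ → ℝ≥0∞, IsRepulsiveFiniteRange v → 0 < scatteringLength v →
    ∃ C_w : ℝ, 0 < C_w ∧ ∃ η_w : ℝ, 0 < η_w ∧
    ∀ κ : ℝ, 0 < κ → ∀ C : ℝ, 0 < C → ∃ A : ℝ, 0 < A ∧ ∃ ρ₀ : ℝ, 0 < ρ₀ ∧
      ∀ ρ : ℝ, 0 < ρ → ρ < ρ₀ →
      ∀ᶠ N : ℕ in atTop, ∀ δ : ℝ≥0∞,
        ENNReal.ofReal (C_w * N * ρ * (scatteringLength v).toReal *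
            (ρ * (scatteringLength v).toReal ^ 3) ^ ((1 : ℝ) / 2 + η_w)) ≤ δ →
        ∃ Φ : TrialState N (sideLength ρ N),
          energy v Φ ≤ groundStateEnergy v N (sideLength ρ N) + δ ∧
          ∀ K : ℕ, Even K → 0 < K → InWindow A ρ (sideLength ρ N) K →
            (∑ q ∈ (Finset.univ.filter fun q : SubIdx K =>
                0 < pathDispersion K q ∧
                  pathDispersion K q < horizonThreshold C κ (scatteringLength v).toReal A ρ),
              occupation N (boxBlockWave (sideLength ρ N) K q) Φ.ψ) ≤ ENNReal.ofReal ((N : ℝ) / 64)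

/-- **WIT-fine** (the g31 residual re-cut: the sub-`δ⋆` regime only). [folklore] -/
@[conjecture] def SubHorizonWitnessFine : Prop :=
  ∀ v : ℝ → ℝ≥0∞, IsRepulsiveFiniteRange v → 0 < scatteringLength v →
    ∀ C_w : ℝ, 0 < C_w → ∀ η_w : ℝ, 0 < η_w →
    ∀ κ : ℝ, 0 < κ → ∀ C : ℝ, 0 < C → ∃ A : ℝ, 0 < A ∧ ∃ ρ₀ : ℝ, 0 < ρ₀ ∧
      ∀ ρ : ℝ, 0 < ρ → ρ < ρ₀ →
      ∀ᶠ N : ℕ in atTop, ∀ δ : ℝ≥0∞, 0 < δ →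
        δ < ENNReal.ofReal (C_w * N * ρ * (scatteringLength v).toReal *
            (ρ * (scatteringLength v).toReal ^ 3) ^ ((1 : ℝ) / 2 + η_w)) →
        ∃ Φ : TrialState N (sideLength ρ N),
          energy v Φ ≤ groundStateEnergy v N (sideLength ρ N) + δ ∧
          ∀ K : ℕ, Even K → 0 < K → InWindow A ρ (sideLength ρ N) K →
            (∑ q ∈ (Finset.univ.filter fun q : SubIdx K =>
                0 < pathDispersion K q ∧
                  pathDispersion K q < horizonThreshold C κ (scatteringLength v).toReal A ρ),
              occupation N (boxBlockWave (sideLength ρ N) K q) Φ.ψ) ≤ ENNReal.ofReal ((N : ℝ) / 64)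

/-- **WIT-coarse, `∀ A` form** (the rung stated for every block constant `A`, which is how the trial-state
proof gives it: the witness does not depend on `A`). [folklore] -/
@[conjecture] def SubHorizonWitnessCoarseAllA : Prop :=
  ∀ v : ℝ → ℝ≥0∞, IsRepulsiveFiniteRange v → 0 < scatteringLength v →
    ∃ C_w : ℝ, 0 < C_w ∧ ∃ η_w : ℝ, 0 < η_w ∧
    ∀ κ : ℝ, 0 < κ → ∀ C : ℝ, 0 < C → ∀ A : ℝ, 0 < A → ∃ ρ₀ : ℝ, 0 < ρ₀ ∧
      ∀ ρ : ℝ, 0 < ρ → ρ < ρ₀ →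
      ∀ᶠ N : ℕ in atTop, ∀ δ : ℝ≥0∞,
        ENNReal.ofReal (C_w * N * ρ * (scatteringLength v).toReal *
            (ρ * (scatteringLength v).toReal ^ 3) ^ ((1 : ℝ) / 2 + η_w)) ≤ δ →
        ∃ Φ : TrialState N (sideLength ρ N),
          energy v Φ ≤ groundStateEnergy v N (sideLength ρ N) + δ ∧
          ∀ K : ℕ, Even K → 0 < K → InWindow A ρ (sideLength ρ N) K →
            (∑ q ∈ (Finset.univ.filter fun q : SubIdx K =>
                0 < pathDispersion K q ∧
                  pathDispersion K q < horizonThreshold C κ (scatteringLength v).toReal A ρ),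
              occupation N (boxBlockWave (sideLength ρ N) K q) Φ.ψ) ≤ ENNReal.ofReal ((N : ℝ) / 64)

/-- Bookkeeping seam `WIT ⟸ WIT-coarse(∀A) ∧ WIT-fine` (split on `δ⋆ ≤ δ`). NOT a reduction — see
`subHorizonWitness_of_fine`. [folklore] -/
theorem subHorizonWitness_of_coarse_fine (hC : SubHorizonWitnessCoarseAllA) (hF : SubHorizonWitnessFine) :
    SubHorizonWitness := by
  intro v hv ha κ hκ C hC0
  obtain ⟨C_w, hCw, η_w, hηw, hcoarse⟩ := hC v hv ha
  obtain ⟨A, hA, ρ₁, hρ₁, hfine⟩ := hF v hv ha C_w hCw η_w hηw κ hκ C hC0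
  obtain ⟨ρ₂, hρ₂, hcoarseA⟩ := hcoarse κ hκ C hC0 A hA
  refine ⟨A, hA, min ρ₁ ρ₂, lt_min hρ₁ hρ₂, fun ρ hρ hρlt => ?_⟩
  filter_upwards [hfine ρ hρ (lt_of_lt_of_le hρlt (min_le_left _ _)),
    hcoarseA ρ hρ (lt_of_lt_of_le hρlt (min_le_right _ _))] with N hNf hNc
  intro δ hδ
  by_cases hreg : ENNReal.ofReal (C_w * N * ρ * (scatteringLength v).toReal *
      (ρ * (scatteringLength v).toReal ^ 3) ^ ((1 : ℝ) / 2 + η_w)) ≤ δ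
  · exact hNc δ hreg
  · exact hNf δ hδ (lt_of_not_ge hreg)

/-- **`δ`-monotonicity makes the fine piece the whole of WIT**: a witness at excess `δ' < δ⋆` is a
witness at every `δ ≥ δ'`, so `SubHorizonWitnessFine → SubHorizonWitness` outright (for `δ ≥ δ⋆` use the
fine witness at `δ⋆/2`). Kernel record of the lens-6 dead end «δ-regime split of WIT = COSTUME».
[folklore] -/
theorem subHorizonWitness_of_fine (hF : SubHorizonWitnessFine) : SubHorizonWitness := by
  intro v hv ha κ hκ C hC0
  obtain ⟨A, hA, ρ₁, hρ₁, hfine⟩ := hF v hv ha 1 one_pos 1 one_pos κ hκ C hC0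
  refine ⟨A, hA, ρ₁, hρ₁, fun ρ hρ hρlt => ?_⟩
  filter_upwards [hfine ρ hρ hρlt, eventually_ge_atTop 1] with N hNf hN1
  intro δ hδ
  set δs : ℝ≥0∞ := ENNReal.ofReal (1 * N * ρ * (scatteringLength v).toReal *
      (ρ * (scatteringLength v).toReal ^ 3) ^ ((1 : ℝ) / 2 + 1)) with hδs
  by_cases hreg : δ < δs
  · exact hNf δ hδ hreg
  · -- `δs ≤ δ`: use the fine witness at `δs / 2`
    have hapos : 0 < (scatteringLength v).toReal :=
      ENNReal.toReal_pos (ne_of_gt ha) (hv.scatteringLength_ne_top)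
    have hN : (1 : ℝ) ≤ N := by exact_mod_cast hN1
    have hδs_pos : 0 < δs := by
      rw [hδs, ENNReal.ofReal_pos]; positivity
    have hδs_top : δs ≠ ⊤ := ENNReal.ofReal_ne_top
    have hhalf_pos : 0 < δs / 2 := ENNReal.div_pos hδs_pos.ne' (by norm_num)
    have hhalf_lt : δs / 2 < δs := ENNReal.half_lt_self hδs_pos.ne' hδs_top
    obtain ⟨Φ, hE, hband⟩ := hNf (δs / 2) hhalf_pos hhalf_lt
    refine ⟨Φ, hE.trans (add_le_add le_rfl ?_), hband⟩
    exact hhalf_lt.le.trans (le_of_not_gt hreg)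

end Summit.AtomisticToContinuum.BoseEinsteinCondensation.Theorems.BoxHorizonTransfer

end
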